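import Summits.ResolutionOfSingularities.ResolutionOfSingularities.Theorems.PurelyInseparableDim4ResConeHeavyEntryFrame
import Summits.ResolutionOfSingularities.ResolutionOfSingularities.Theorems.PurelyInseparableDim4ResConeDInfFrames
import HarnessLib
import HarnessLib.Audit.Tags

/-!
# Purely inseparable four-folds — the `(p, p−1)` HEAVY LINE, p-GENERIC: the KEEP-H / HIT-H step pattern DERIVED from the D∞-shape
# class binder, and the `(2)`-state on the chain (cell `res-dim4-pi`, K2(p) lane, slice C `(p, p−1)`; HOLDER RULING 2026-08-29 08:19Z (3)
# «K_gen + ASSEMBLY_gen + the (p, p−1) heavy-line theorem over the D∞-SHAPE binder → p-7»; kernel hand res-dim4-p-7 g5)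

[OURS · counted 0 · cell `res-dim4-pi` · K2(p) lane (holder res-dim4-p-12 g4); the p-generic twin of the D∞ half of W₄
`…ResConeFourWeights` (`dInf_pattern`) and of `…ResConeDInfFrames` §2, over res-dim4-p-9 g5's any-`(p, d)` tail bookkeeping
`tail_weights_laws` (`…ResConeHeavyEntryFrame`); kernel hand res-dim4-p-7 g5.]  Nothing here proves K2(p), K2(7), `NoIsolatedTrap p p`
or resolution of singularities in dimension ≥ 4 / characteristic `p` — NOT proved.  AI kernel work, weaker than expert review.

THE D∞-SHAPE CLASS (named binder): from `k₁` on every state has ONE letter of weight `2` (the HEAVY letter, supercritical by one at shade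
`d = p − 1`: `r_h + d = p + 1`), the others `≤ 1`, and `2 ≤ |r_k| ≤ 3` (`(2)`-states and `(2,1)`-states).  CAVEAT OF RECORD (holder,
res-dim4-p-5 g5's ledger census, res-dim4-idea-4 memo §5/§11.1): «light pair + D∞-shape» exhausts slice C`(p, p−1)` ONLY at `p = 5` (W₄
`four_weights_dichotomy`); at `p ≥ 7` the heavy part of slice C`(p, p−1)` is a zoo (`(2,2)`, `(3)`, `(3,2)`, `(4)`, `(2,2,1)`, … at
`(7,6)`) and the D∞-shape class is ONE of its recurrent classes — this line kills exactly that class, as a HYPOTHESIS-shaped theorem.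

* §1 THE PATTERN FROM THE CLASS (pure weight arithmetic under the boundary law `r_{k+1} = (r_k|_{b_k = 0}).update (j k) (|r_k| + d − p)`
  with `d + 1 = p`; no pair bound): **`heavyLine_keep_of_class`** — at a `(2)`-state the step KEEPS the heavy letter `W` (`j k ≠ W`,
  `b k W = 0`, `r_{k+1} W = 2`) and the newborn letter weighs `1` (else `|r_{k+1}| = 1`); **`heavyLine_hit_of_class`** — at a
  `(2,1)`-state the newborn letter weighs `2` and the step HITS `W` (`j k = W ∨ b k W ≠ 0`; else two weight-`2` letters), hence the
  step direction is transversal to `W` (`heavyLine_direction_ne_zero`); `heavyLine_succ_degree_three_of_two` (a `(2)`-state is followed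
  by a `(2,1)`-state);
* §2 ON THE CHAIN: **`heavyLine_two_state`** (`r_k = 2e_W`, `o_k = d + 2`, KEEP-H shape) and `heavyLine_two_state_newborn` (`r′_{j k} = 1`,
  `r′_W = 2`, both prime to `p ≥ 3`: the cleaning correction of (K-Φ2) II lies in `(x_{j k}^{d}) ∩ (x_W^{d−1})`).
Def-free; every prime `p` with `d + 1 = p` (`3 ≤ p` where `p ∤ 2` is needed).
[cite: CossartJannsenSaito2020, Thm. 3.14] [cite: HauserPerlega2019PRIMS, §2 (transform D′ of D)]
bears_on: LADDER-RESOLUTION:D157-DOOR2 (res-dim4-pi · K2(p) · slice C (p, p−1) heavy line, pattern).  Supports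
stmt-ResolutionOfSingularities-16155 (helper).
-/

set_option linter.dupNamespace false -- mandated namespace of this single-conjunct summit

noncomputable section

namespace Summit.ResolutionOfSingularities.ResolutionOfSingularities.Theorems.PIDim4

namespace ResCone

open MvPolynomial Finset IsLocalRing
open Literature.AlgebraicGeometry.Resolution
open Literature.AlgebraicGeometry.Resolution.CentreBlowup
open Literature.AlgebraicGeometry.Resolution.Hauser2010
open Literature.AlgebraicGeometry.Resolution.HauserPerlega2019
open Literature.AlgebraicGeometry.Resolution.WeightedOrder
open PointBlowup (direction)

variable {K : Type} [Field K]

/-! ## 1. The KEEP-H / HIT-H pattern from the class binder -/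

section Pattern

variable [DecidableEq K] {p d : ℕ} {r : ℕ → Fin 4 →₀ ℕ} {j : ℕ → Fin 4} {b : ℕ → Fin 4 → K} {k₁ : ℕ}

/-- If `r m = 1` and `r i = 0` for `i ≠ m` then `|r| = 1`. [folklore] -/
theorem degree_eq_one_of_apply {r : Fin 4 →₀ ℕ} {m : Fin 4} (hm : r m = 1) (hoff : ∀ i, i ≠ m → r i = 0) :
    r.degree = 1 := by
  have hr : r = Finsupp.single m 1 := by
    ext i
    by_cases him : i = m
    · rw [him, Finsupp.single_eq_same, hm]
    · rw [Finsupp.single_eq_of_ne him, hoff i him]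
  rw [hr, Finsupp.degree_single]

/-- **KEEP-H AT A `(2)`-STATE, FROM THE CLASS.**  Under the boundary law with `d + 1 = p`, at a state with `|r_k| = 2`, heavy letter
`r_k W = 2`, and `2 ≤ |r_{k+1}|`: the step keeps `W` — `j k ≠ W`, `b k W = 0`, `r_{k+1} W = 2` — and the newborn letter weighs
`r_{k+1} (j k) = 1` (hitting or translating `W` would leave `|r_{k+1}| = 1`). [OURS] [cite: CossartJannsenSaito2020, Thm. 3.14] -/
theorem heavyLine_keep_of_class (hdp : d + 1 = p)
    (hlaw : ∀ k, k₁ ≤ k → r (k + 1) = ((r k).filter (fun i => b k i = 0)).update (j k) ((r k).degree + d - p))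
    (hfl : ∀ k, k₁ ≤ k → 2 ≤ (r k).degree) {k : ℕ} (hk : k₁ ≤ k) (h2 : (r k).degree = 2) {W : Fin 4}
    (hW : r k W = 2) : j k ≠ W ∧ b k W = 0 ∧ r (k + 1) W = 2 ∧ r (k + 1) (j k) = 1 := by
  have hzero : ∀ i, i ≠ W → r k i = 0 := fun i hi => apply_eq_zero_of_degree_two h2 hW hi
  have hr1 := hlaw k hk
  rw [h2, show 2 + d - p = 1 by omega] at hr1
  have hnew : r (k + 1) (j k) = 1 := by rw [hr1, Finsupp.coe_update, Function.update_self]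
  have hoth : ∀ i, i ≠ j k → r (k + 1) i = if b k i = 0 then r k i else 0 := fun i hi => by
    rw [hr1, Finsupp.coe_update, Function.update_of_ne hi, Finsupp.filter_apply]
  have hfl1 := hfl (k + 1) (by omega)
  -- the step cannot hit `W` …
  have hjW : j k ≠ W := by
    intro hjW
    have hoff : ∀ i, i ≠ j k → r (k + 1) i = 0 := fun i hi => by
      rw [hoth i hi, hzero i (hjW ▸ hi)]; simp
    have := degree_eq_one_of_apply hnew hoff
    omega
  -- … nor translate it
  have hbW : b k W = 0 := by
    by_contra hbW
    have hoff : ∀ i, i ≠ j k → r (k + 1) i = 0 := fun i hi => by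
      rw [hoth i hi]
      by_cases hiW : i = W
      · rw [hiW, if_neg hbW]
      · rw [hzero i hiW]; simp
    have := degree_eq_one_of_apply hnew hoff
    omega
  refine ⟨hjW, hbW, ?_, hnew⟩
  rw [hoth W hjW.symm, if_pos hbW, hW]

/-- **HIT-H AT A `(2,1)`-STATE, FROM THE CLASS.**  Under the boundary law with `d + 1 = p`, at a state with `|r_k| = 3` and heavy letter
`r_k W = 2`, if the child has a UNIQUE weight-`2` letter (the others `≤ 1`): the newborn letter weighs `r_{k+1} (j k) = 2` and the step
hits `W` (`j k = W ∨ b k W ≠ 0`) — else `W` and `j k` would both weigh `2`. [OURS] [cite: CossartJannsenSaito2020, Thm. 3.14] -/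
theorem heavyLine_hit_of_class (hdp : d + 1 = p)
    (hlaw : ∀ k, k₁ ≤ k → r (k + 1) = ((r k).filter (fun i => b k i = 0)).update (j k) ((r k).degree + d - p))
    (hcl : ∀ k, k₁ ≤ k → ∃ W, r k W = 2 ∧ ∀ i, i ≠ W → r k i ≤ 1) {k : ℕ} (hk : k₁ ≤ k) (h3 : (r k).degree = 3)
    {W : Fin 4} (hW : r k W = 2) : (j k = W ∨ b k W ≠ 0) ∧ r (k + 1) (j k) = 2 := by
  have hr1 := hlaw k hk
  rw [h3, show 3 + d - p = 2 by omega] at hr1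
  have hnew : r (k + 1) (j k) = 2 := by rw [hr1, Finsupp.coe_update, Function.update_self]
  refine ⟨?_, hnew⟩
  by_contra hno
  push Not at hno
  obtain ⟨hjW, hbW⟩ := hno
  have hWkept : r (k + 1) W = 2 := by
    rw [hr1, Finsupp.coe_update, Function.update_of_ne (Ne.symm hjW), Finsupp.filter_apply_pos (fun i => b k i = 0) (r k) hbW, hW]
  obtain ⟨W', -, hle⟩ := hcl (k + 1) (by omega)
  have h1 : j k = W' := by
    by_contra h; have := hle (j k) h; omega
  have h2 : W = W' := by
    by_contra h; have := hle W h; omega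
  exact hjW (h1.trans h2.symm)

omit [DecidableEq K] in
/-- The HIT-H step is TRANSVERSAL to the heavy letter: `(direction (j k) (b k)) W ≠ 0` (the `hdirW` binder of res-dim4-p-9's
`heavy_entryFrame`). [OURS] [folklore] -/
theorem heavyLine_direction_ne_zero {k : ℕ} {W : Fin 4} (hbj : b k (j k) = 0) (hhit : j k = W ∨ b k W ≠ 0) :
    direction (j k) (b k) W ≠ 0 := by
  rcases hhit with hjW | hbW
  · rw [← hjW]
    show Function.update (b k) (j k) 1 (j k) ≠ 0
    rw [Function.update_self]; exact one_ne_zero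
  · have hjW : j k ≠ W := fun hh => hbW (by rw [← hh]; exact hbj)
    show Function.update (b k) (j k) 1 W ≠ 0
    rw [Function.update_of_ne (Ne.symm hjW)]; exact hbW

/-- **A `(2)`-STATE IS FOLLOWED BY A `(2,1)`-STATE** (class + boundary law, `d + 1 = p`): `|r_{k+1}| = 3`. [OURS] [folklore] -/
theorem heavyLine_succ_degree_three_of_two (hdp : d + 1 = p)
    (hlaw : ∀ k, k₁ ≤ k → r (k + 1) = ((r k).filter (fun i => b k i = 0)).update (j k) ((r k).degree + d - p))
    (hfl : ∀ k, k₁ ≤ k → 2 ≤ (r k).degree) {k : ℕ} (hk : k₁ ≤ k) (h2 : (r k).degree = 2) {W : Fin 4}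
    (hW : r k W = 2) : (r (k + 1)).degree = 3 := by
  obtain ⟨hjW, hbW, hW', hnew⟩ := heavyLine_keep_of_class hdp hlaw hfl hk h2 hW
  have hzero : ∀ i, i ≠ W → r k i = 0 := fun i hi => apply_eq_zero_of_degree_two h2 hW hi
  have hr1 := hlaw k hk
  rw [h2] at hr1
  have hoff : ∀ i, i ≠ j k → i ≠ W → r (k + 1) i = 0 := fun i hi hiW => by
    rw [hr1, Finsupp.coe_update, Function.update_of_ne hi, Finsupp.filter_apply, hzero i hiW]; simp
  have hr : r (k + 1) = Finsupp.single W 2 + Finsupp.single (j k) 1 := by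
    ext i
    rw [Finsupp.add_apply]
    by_cases hiW : i = W
    · rw [hiW, hW', Finsupp.single_eq_same, Finsupp.single_eq_of_ne hjW.symm, add_zero]
    · by_cases hij : i = j k
      · rw [hij, hnew, Finsupp.single_eq_same, Finsupp.single_eq_of_ne hjW, zero_add]
      · rw [hoff i hij hiW, Finsupp.single_eq_of_ne hiW, Finsupp.single_eq_of_ne hij, add_zero]
  rw [hr, map_add, Finsupp.degree_single, Finsupp.degree_single]

end Pattern

/-! ## 2. The `(2)`-state of the D∞-shape class on the chain -/

section TwoState

variable (p : ℕ) [hp : Fact p.Prime] [DecidableEq K]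

/-- **THE `(2)`-STATE OF THE `(p, p−1)` D∞-SHAPE CLASS AND ITS KEEP-H STEP.**  On a witnessed isolated above-floor `Step0 p` chain with
`x^{r₀} ∣ F₀` and constant shade `d`, `d + 1 = p`, from `k₀`, in the class from `k₁ ≥ k₀`: at `k ≥ k₁` with `|r_k| = 2` and heavy letter
`r_k W = 2`, every other weight vanishes, `ord₀ F_k = d + 2`, and the step is KEEP-H (`j k ≠ W`, `b k W = 0`, `r_{k+1} W = 2`,
`r_{k+1} (j k) = 1`). [OURS · bookkeeping] [cite: CossartJannsenSaito2020, Thm. 3.14] -/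
theorem heavyLine_two_state {c : ℕ → State K} {j : ℕ → Fin 4} {b : ℕ → Fin 4 → K}
    (hc : ∀ k, IsIsolated p (c k).F ∧ Step0 p (c k) (c (k + 1))) (hw : FreeTail.IsWitnessedChain p c j b)
    (hr0 : ∀ e ∈ (c 0).F.support, (c 0).r ≤ e) (hfloor : ∀ k, ordZero (c k).F ≠ p) {k₀ d : ℕ} (hdp : d + 1 = p)
    (hshade : ∀ k, k₀ ≤ k → (c k).shade = ((d : ℕ) : ℕ∞)) {k₁ : ℕ} (hk₁ : k₀ ≤ k₁)
    (hD : ∀ k, k₁ ≤ k → (∃ W, (c k).r W = 2 ∧ ∀ i, i ≠ W → (c k).r i ≤ 1) ∧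
      (2 ≤ (c k).r.degree ∧ (c k).r.degree ≤ 3))
    {k : ℕ} (hk : k₁ ≤ k) (h2 : (c k).r.degree = 2) {W : Fin 4} (hW : (c k).r W = 2) :
    (∀ i, i ≠ W → (c k).r i = 0) ∧ ordZero (c k).F = ((d + 2 : ℕ) : ℕ∞) ∧
      j k ≠ W ∧ b k W = 0 ∧ (c (k + 1)).r W = 2 ∧ (c (k + 1)).r (j k) = 1 := by
  obtain ⟨hord, hlaw, -, -, -⟩ := tail_weights_laws hc hw hr0 hfloor hshade
  obtain ⟨hjW, hbW, hW', hnew⟩ := heavyLine_keep_of_class (r := fun k => (c k).r) (k₁ := k₁) hdp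
    (fun k hk => hlaw k (by omega)) (fun k hk => (hD k hk).2.1) hk h2 hW
  refine ⟨fun i hi => apply_eq_zero_of_degree_two h2 hW hi, ?_, hjW, hbW, hW', hnew⟩
  rw [hord k (by omega), h2]; congr 1; omega

omit hp in
/-- The newborn exponent of the KEEP-H step at a `(2)`-state is `|r_k| + d − p = 1` and the heavy exponent stays `2`; for `p ≥ 3`
both are prime to `p`. [OURS · bookkeeping] [folklore] -/
theorem heavyLine_two_state_newborn {d : ℕ} (hdp : d + 1 = p) (hp3 : 3 ≤ p) {r : Fin 4 →₀ ℕ} (h2 : r.degree = 2)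
    {h m : Fin 4} (hhm : h ≠ m) {b : Fin 4 → K} (hbh : b h = 0) (hrh : r h = 2) :
    ((r.filter fun i => b i = 0).update m (r.degree + d - p)) m = 1 ∧
      ((r.filter fun i => b i = 0).update m (r.degree + d - p)) h = 2 ∧
      ¬ p ∣ ((r.filter fun i => b i = 0).update m (r.degree + d - p)) m ∧
      ¬ p ∣ ((r.filter fun i => b i = 0).update m (r.degree + d - p)) h := by
  have hm : ((r.filter fun i => b i = 0).update m (r.degree + d - p)) m = 1 := by
    rw [Finsupp.coe_update, Function.update_self, h2]; omega
  have hh : ((r.filter fun i => b i = 0).update m (r.degree + d - p)) h = 2 := by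
    rw [Finsupp.coe_update, Function.update_of_ne hhm, Finsupp.filter_apply_pos (fun i => b i = 0) r hbh, hrh]
  refine ⟨hm, hh, ?_, ?_⟩
  · rw [hm]; intro hdvd; have := Nat.le_of_dvd one_pos hdvd; omega
  · rw [hh]; intro hdvd; have := Nat.le_of_dvd two_pos hdvd; omega

end TwoState

end ResCone

end Summit.ResolutionOfSingularities.ResolutionOfSingularities.Theorems.PIDim4

end
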